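import Mathlib
import Literature.RingTheory.CohomologyAnnihilator.Compactness
import Literature.RingTheory.CohomologyAnnihilator.TowerRestrict
import Literature.RingTheory.CohomologyAnnihilator.FreeBaseChangeCopower
import Literature.RingTheory.CohomologyAnnihilator.SingEqVCaOfDescent
import Literature.RingTheory.CohomologyAnnihilator.StrongGeneratorDescentField
import HarnessLib

/-!
# Descent of a finitely presented `(A ⊗ₖ K)`-module to a finite subextension; the copower structure

Topic: `Literature/RingTheory/CohomologyAnnihilator`. The descent step in the proof of
[IyengarTakahashi2014, Theorem 5.4]: for an ALGEBRAIC extension `K/k`, a `k`-algebra `A` and a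
finitely generated module `C` over `A ⊗ₖ K`, "there exists a finite field extension `l` of `k`
and a finitely generated `(A ⊗ₖ l)`-module `G` such that `C ≅ G ⊗ₗ K`", and "the `A`-module
`G ⊗ₗ K` is a (possibly infinite) direct sum of copies of `G`". Proved here, in coordinates:

* `nonempty_quotient_linearEquiv_finsupp` — if the generators of a submodule `N ≤ (A ⊗ₖ K)ⁿ`
  come from `(A ⊗ₖ L)ⁿ` for a subfield `k ⊆ L ⊆ K`, then `(A ⊗ₖ K)ⁿ/N ≃ ⊕_ι (A ⊗ₖ L)ⁿ/N'` as
  `A`-modules, `N'` the `(A ⊗ₖ L)`-span of the same generators and `ι` indexing an `L`-basis of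
  `K` (the map `⊕_ι (A ⊗ₖ L)ⁿ → (A ⊗ₖ K)ⁿ`, `(y_i)_i ↦ Σ_i (1 ⊗ b_i) y_i`, is an `A`-linear
  isomorphism carrying `⊕_ι N'` onto `N`);
* `exists_iso_finsupp_restrictScalars` — for `K/k` algebraic, every finitely presented
  `(A ⊗ₖ K)`-module `C` restricts to an `A`-module isomorphic to a copower `ι →₀ G` of a FINITELY
  GENERATED `A`-module `G` (the finitely many elements of `K` occurring in a presentation matrix
  generate a finite subextension `l`, and `A ⊗ₖ l` is module-finite over `A`);
  `exists_isRetractOfCopower_restrictScalars` — hence `C|_A ∈ Add G` (`Compactness.lean`);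
* `generatorDescent_isRetractOfCopower` — the same in the orientation `K ⊗ₖ A` (restriction along
  `a ↦ 1 ⊗ a`), VERBATIM the hypothesis `hAdd` of `strongGenerator_descent_of_generatorDescent`
  (`StrongGeneratorDescentField.lean`);
* `singEqVCa_essFiniteType_holds` — consequently the named fact `singEqVCa_essFiniteType`
  ([IyengarTakahashi2014, Theorem 5.4]: `V(ca R) = V(ca^{2d+1} R) = Sing R` for localisations of
  finitely generated algebras over a field) is DISCHARGED: `singEqVCa_essFiniteType_of_descent`
  (`SingEqVCaOfDescent.lean`: Theorem 3.6 over perfect fields + Theorem 5.2) applied to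
  `strongGenerator_descent_of_generatorDescent generatorDescent_isRetractOfCopower`.

## References

* S. B. Iyengar, R. Takahashi, *Annihilation of cohomology and strong generation of module
  categories*, IMRN 2016; arXiv:1404.1476 — proof of Theorem 5.4. [`IyengarTakahashi2014`]
-/

noncomputable section

open CategoryTheory
open scoped TensorProduct

universe u

namespace Literature.RingTheory.CohomologyAnnihilator

section Descent

variable (k K A : Type u) [Field k] [Field K] [Algebra k K] [CommRing A] [Algebra k A]

/-- **The copower structure of a base-changed presentation.** For fields `k ⊆ L ⊆ K`, a
`k`-algebra `A`, and `N ≤ (A ⊗ₖ K)ⁿ` the `(A ⊗ₖ K)`-span of vectors coming from `S ⊆ (A ⊗ₖ L)ⁿ`: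
`(A ⊗ₖ K)ⁿ / N ≃ ι →₀ (A ⊗ₖ L)ⁿ / N'` as `A`-modules, `N'` the `(A ⊗ₖ L)`-span of `S`, `ι`
indexing an `L`-basis of `K`. [cite: IyengarTakahashi2014, Thm. 5.4 (proof)] -/
theorem nonempty_quotient_linearEquiv_finsupp (L : Type u) [Field L] [Algebra k L] [Algebra L K]
    [IsScalarTower k L K] {n : ℕ} (N : Submodule (A ⊗[k] K) (Fin n → A ⊗[k] K))
    (S : Set (Fin n → A ⊗[k] L))
    (hS : Submodule.span (A ⊗[k] K)
      (((Algebra.TensorProduct.map (AlgHom.id A A)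
        (IsScalarTower.toAlgHom k L K)).toLinearMap.compLeft (Fin n)) '' S) = N) :
    Nonempty (((Fin n → A ⊗[k] K) ⧸ N) ≃ₗ[A]
      (Module.Free.ChooseBasisIndex L K →₀
        ((Fin n → A ⊗[k] L) ⧸ Submodule.span (A ⊗[k] L) S))) := by
  classical
  -- notation: the inclusion `A ⊗ₖ L → A ⊗ₖ K` and its componentwise extension
  let incl : A ⊗[k] L →ₐ[A] A ⊗[k] K :=
    Algebra.TensorProduct.map (AlgHom.id A A) (IsScalarTower.toAlgHom k L K)
  have hincl : ∀ (a : A) (y : L), incl (a ⊗ₜ[k] y) = a ⊗ₜ[k] algebraMap L K y := fun a y => by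
    simp only [incl, Algebra.TensorProduct.map_tmul, AlgHom.coe_id, id_eq,
      IsScalarTower.coe_toAlgHom']
  let incl' : (Fin n → A ⊗[k] L) →ₗ[A] (Fin n → A ⊗[k] K) := incl.toLinearMap.compLeft (Fin n)
  have hincl' : ∀ (w : Fin n → A ⊗[k] L) (j : Fin n), incl' w j = incl (w j) := fun w j => rfl
  set N' : Submodule (A ⊗[k] L) (Fin n → A ⊗[k] L) := Submodule.span (A ⊗[k] L) S with hN'
  -- `incl'` is semilinear over `incl` and maps `N'` into `N`
  have hincl'_smul : ∀ (z : A ⊗[k] L) (w : Fin n → A ⊗[k] L), incl' (z • w) = incl z • incl' w := by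
    intro z w
    funext j
    rw [hincl', Pi.smul_apply, Pi.smul_apply, smul_eq_mul, smul_eq_mul, map_mul, hincl']
  have hN'N : ∀ w ∈ N', incl' w ∈ N := by
    intro w hw
    induction hw using Submodule.span_induction with
    | mem x hx =>
      rw [← hS]
      exact Submodule.subset_span ⟨x, hx, rfl⟩
    | zero => rw [map_zero]; exact N.zero_mem
    | add x y _ _ hx hy => rw [map_add]; exact N.add_mem hx hy
    | smul z x _ hx => rw [hincl'_smul]; exact N.smul_mem _ hx
  -- (1) an `L`-basis of `K` and the `A`-linear isomorphism `A ⊗ₖ K ≃ ι →₀ A ⊗ₖ L`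
  set ι := Module.Free.ChooseBasisIndex L K with hι
  let b : Module.Basis ι L K := Module.Free.chooseBasis L K
  let Φ : A ⊗[k] K ≃ₗ[A] (ι →₀ A ⊗[k] L) :=
    (TensorProduct.AlgebraTensorModule.congr (LinearEquiv.refl A A) (b.repr.restrictScalars k))
      ≪≫ₗ TensorProduct.finsuppRight k A A L ι
  have hΦsymm_single : ∀ (i : ι) (z : A ⊗[k] L),
      Φ.symm (Finsupp.single i z) = ((1 : A) ⊗ₜ[k] b i) * incl z := by
    intro i
    suffices h : Φ.symm.toLinearMap ∘ₗ Finsupp.lsingle i =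
        (LinearMap.mulLeft A ((1 : A) ⊗ₜ[k] b i)) ∘ₗ incl.toLinearMap from
      fun z => LinearMap.congr_fun h z
    refine TensorProduct.AlgebraTensorModule.ext fun a y => ?_
    simp only [LinearMap.coe_comp, Function.comp_apply, Finsupp.lsingle_apply,
      LinearEquiv.coe_coe, AlgHom.toLinearMap_apply, LinearMap.mulLeft_apply, hincl]
    rw [show Φ.symm = (TensorProduct.finsuppRight k A A L ι).symm ≪≫ₗ
      (TensorProduct.AlgebraTensorModule.congr (LinearEquiv.refl A A)
        (b.repr.restrictScalars k)).symm from rfl, LinearEquiv.trans_apply,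
      TensorProduct.finsuppRight_symm_apply_single,
      TensorProduct.AlgebraTensorModule.congr_symm_tmul]
    simp only [LinearEquiv.refl_symm, LinearEquiv.refl_apply,
      LinearEquiv.restrictScalars_symm_apply, Module.Basis.repr_symm_single,
      Algebra.TensorProduct.tmul_mul_tmul, one_mul]
    rw [Algebra.smul_def, mul_comm]
  -- (2) the `A`-linear isomorphism `Θ : (ι →₀ (A ⊗ₖ L)ⁿ) ≃ (A ⊗ₖ K)ⁿ`, `(y_i) ↦ Σ (1 ⊗ b_i) y_i`
  let F : ι → (Fin n → A ⊗[k] L) →ₗ[A] (Fin n → A ⊗[k] K) := fun i =>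
    ((LinearMap.lsmul (A ⊗[k] K) (Fin n → A ⊗[k] K) ((1 : A) ⊗ₜ[k] b i)).restrictScalars A) ∘ₗ incl'
  let Θ : (ι →₀ (Fin n → A ⊗[k] L)) →ₗ[A] (Fin n → A ⊗[k] K) := Finsupp.lsum ℕ F
  have hΘ : ∀ f : ι →₀ (Fin n → A ⊗[k] L),
      Θ f = f.sum fun i w => ((1 : A) ⊗ₜ[k] b i) • incl' w := fun f => by
    simp only [Θ, Finsupp.lsum_apply]
    rfl
  -- coordinates of `Θ f`
  have hΘcoord : ∀ (f : ι →₀ (Fin n → A ⊗[k] L)) (j : Fin n),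
      Θ f j = Φ.symm (Finsupp.mapRange (fun w : Fin n → A ⊗[k] L => w j) rfl f) := by
    intro f j
    rw [hΘ, Finsupp.sum, Finset.sum_apply]
    rw [show Φ.symm (Finsupp.mapRange (fun w : Fin n → A ⊗[k] L => w j) rfl f) =
      (Finsupp.mapRange (fun w : Fin n → A ⊗[k] L => w j) rfl f).sum
        (fun i z => Φ.symm (Finsupp.single i z))
      from by rw [← map_finsuppSum, Finsupp.sum_single]]
    rw [Finsupp.sum_mapRange_index (fun i => by rw [Finsupp.single_zero, map_zero])]
    refine Finset.sum_congr rfl fun i _ => ?_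
    dsimp only
    rw [hΦsymm_single, Pi.smul_apply, smul_eq_mul, hincl']
  have hΘinj : Function.Injective Θ := by
    intro f g hfg
    ext i j
    have h := congr_fun hfg j
    rw [hΘcoord, hΘcoord, Φ.symm.injective.eq_iff] at h
    simpa using DFunLike.congr_fun h i
  have hΘsurj : Function.Surjective Θ := by
    intro v
    let g : Fin n → (ι →₀ A ⊗[k] L) := fun j => Φ (v j)
    refine ⟨∑ j, Finsupp.mapRange (fun z : A ⊗[k] L => (Pi.single j z : Fin n → A ⊗[k] L))
      (by simp) (g j), ?_⟩
    funext j'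
    rw [hΘcoord]
    have : Finsupp.mapRange (fun w : Fin n → A ⊗[k] L => w j') rfl
        (∑ j, Finsupp.mapRange (fun z : A ⊗[k] L => (Pi.single j z : Fin n → A ⊗[k] L))
          (by simp) (g j)) = g j' := by
      ext i
      simp only [Finsupp.mapRange_apply, Finsupp.coe_finsetSum, Finset.sum_apply,
        Pi.single_apply]
      rw [Finset.sum_ite_eq Finset.univ j' (fun j => g j i)]
      simp
    rw [this]
    exact Φ.symm_apply_apply (v j')
  let ΘE : (ι →₀ (Fin n → A ⊗[k] L)) ≃ₗ[A] (Fin n → A ⊗[k] K) :=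
    LinearEquiv.ofBijective Θ ⟨hΘinj, hΘsurj⟩
  -- (3) the submodule `V' = ι →₀ N'` and its image `N`
  let V' : Submodule A (ι →₀ (Fin n → A ⊗[k] L)) :=
    ⨅ i, (N'.restrictScalars A).comap (Finsupp.lapply i)
  have hV' : ∀ f : ι →₀ (Fin n → A ⊗[k] L), f ∈ V' ↔ ∀ i, f i ∈ N' := fun f => by
    simp only [V', Submodule.mem_iInf, Submodule.mem_comap, Finsupp.lapply_apply,
      Submodule.restrictScalars_mem]
  have hΘV'le : ∀ f ∈ V', Θ f ∈ N := by
    intro f hf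
    rw [hΘ, Finsupp.sum]
    refine N.sum_mem fun i _ => ?_
    exact N.smul_mem _ (hN'N _ ((hV' f).1 hf i))
  -- the key: `(1 ⊗ κ) • incl' w ∈ Θ V'` for `κ ∈ K`, `w ∈ N'` (expand `κ` in the basis)
  have hkey : ∀ (κ : K) (w : Fin n → A ⊗[k] L), w ∈ N' →
      ((1 : A) ⊗ₜ[k] κ) • incl' w ∈ V'.map Θ := by
    intro κ w hw
    let g : ι →₀ (Fin n → A ⊗[k] L) :=
      Finsupp.mapRange (fun c : L => ((1 : A) ⊗ₜ[k] c) • w) (by simp) (b.repr κ)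
    have hg : g ∈ V' := by
      rw [hV']
      intro i
      simp only [g, Finsupp.mapRange_apply]
      exact N'.smul_mem _ hw
    refine ⟨g, hg, ?_⟩
    rw [hΘ]
    simp only [g]
    rw [Finsupp.sum_mapRange_index (fun i => by simp)]
    have h1 : ∀ (i : ι) (c : L), ((1 : A) ⊗ₜ[k] b i) • incl' (((1 : A) ⊗ₜ[k] c) • w) =
        ((1 : A) ⊗ₜ[k] (algebraMap L K c * b i)) • incl' w := by
      intro i c
      rw [hincl'_smul, smul_smul, hincl, Algebra.TensorProduct.tmul_mul_tmul, one_mul, mul_comm]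
    simp only [h1]
    rw [Finsupp.sum, ← Finset.sum_smul, ← TensorProduct.tmul_sum]
    congr 2
    conv_rhs => rw [← b.linearCombination_repr κ, Finsupp.linearCombination_apply, Finsupp.sum]
    refine Finset.sum_congr rfl fun i _ => ?_
    rw [Algebra.smul_def]
  -- `N ⊆ Θ V'`: `Θ V'` is an `(A ⊗ₖ K)`-submodule containing the generators
  let M : Submodule (A ⊗[k] K) (Fin n → A ⊗[k] K) :=
    { carrier := V'.map Θ
      zero_mem' := (V'.map Θ).zero_mem
      add_mem' := fun hx hy => (V'.map Θ).add_mem hx hy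
      smul_mem' := by
        intro β x hx
        induction β using TensorProduct.induction_on with
        | zero => rw [zero_smul]; exact (V'.map Θ).zero_mem
        | add β₁ β₂ h₁ h₂ => rw [add_smul]; exact (V'.map Θ).add_mem h₁ h₂
        | tmul a κ =>
          have hax : (a ⊗ₜ[k] κ) • x = a • (((1 : A) ⊗ₜ[k] κ) • x) := by
            rw [← smul_assoc, show a • ((1 : A) ⊗ₜ[k] κ) = a ⊗ₜ[k] κ from by
              rw [TensorProduct.smul_tmul', smul_eq_mul, mul_one]]
          rw [hax]
          refine (V'.map Θ).smul_mem a ?_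
          obtain ⟨f, hf, rfl⟩ := hx
          rw [hΘ, Finsupp.sum, Finset.smul_sum]
          refine (V'.map Θ).sum_mem fun i _ => ?_
          rw [smul_smul, Algebra.TensorProduct.tmul_mul_tmul, one_mul]
          exact hkey _ _ ((hV' f).1 hf i) }
  have hNM : N ≤ M := by
    rw [← hS]
    refine Submodule.span_le.mpr ?_
    rintro _ ⟨s, hs, rfl⟩
    change incl' s ∈ V'.map Θ
    have h := hkey 1 s (Submodule.subset_span hs)
    rwa [show ((1 : A) ⊗ₜ[k] (1 : K)) = (1 : A ⊗[k] K) from rfl, one_smul] at h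
  have hmap : V'.map (ΘE : (ι →₀ (Fin n → A ⊗[k] L)) →ₗ[A] (Fin n → A ⊗[k] K)) =
      N.restrictScalars A := by
    apply le_antisymm
    · rintro _ ⟨f, hf, rfl⟩
      exact hΘV'le f hf
    · intro x hx
      exact hNM hx
  -- (4) `(ι →₀ (A ⊗ₖ L)ⁿ) / V' ≃ ι →₀ ((A ⊗ₖ L)ⁿ / N')`
  let π : (ι →₀ (Fin n → A ⊗[k] L)) →ₗ[A] (ι →₀ ((Fin n → A ⊗[k] L) ⧸ N')) :=
    Finsupp.mapRange.linearMap (N'.mkQ.restrictScalars A)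
  have hπsurj : Function.Surjective π :=
    Finsupp.mapRange_surjective _ (map_zero _) (Submodule.mkQ_surjective N')
  have hπker : LinearMap.ker π = V' := by
    ext f
    rw [LinearMap.mem_ker, hV', Finsupp.ext_iff]
    simp only [π, Finsupp.mapRange.linearMap_apply, Finsupp.mapRange_apply, Finsupp.coe_zero,
      Pi.zero_apply, LinearMap.restrictScalars_apply, Submodule.mkQ_apply,
      Submodule.Quotient.mk_eq_zero]
  exact ⟨(Submodule.Quotient.restrictScalarsEquiv A N).symm ≪≫ₗ
    (Submodule.Quotient.equiv V' (N.restrictScalars A) ΘE hmap).symm ≪≫ₗ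
    (Submodule.quotEquivOfEq V' (LinearMap.ker π) hπker.symm) ≪≫ₗ
    (π.quotKerEquivOfSurjective hπsurj)⟩

/-- **Descent + copower for finitely presented modules over `A ⊗ₖ K`, `K/k` algebraic**: the
restriction to `A` of a finitely presented `(A ⊗ₖ K)`-module `C` is isomorphic to a copower
`ι →₀ G` of a FINITELY GENERATED `A`-module `G` (`G = (A ⊗ₖ l)ⁿ/N'` for the finite subextension
`l` generated by the elements of `K` occurring in a presentation matrix of `C`).
[cite: IyengarTakahashi2014, Thm. 5.4 (proof)] -/
theorem exists_iso_finsupp_restrictScalars [Algebra.IsAlgebraic k K]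
    (C : ModuleCat.{u} (A ⊗[k] K)) [Module.FinitePresentation (A ⊗[k] K) C] :
    ∃ (G : ModuleCat.{u} A) (ι : Type u), Module.Finite A G ∧
      Nonempty ((restrictScalarsFunctor A (A ⊗[k] K)).obj C ≅ ModuleCat.of A (ι →₀ G)) := by
  classical
  -- a finite presentation `C ≅ (A ⊗ₖ K)ⁿ / N`
  obtain ⟨n, N, e, hNfg⟩ := Module.FinitePresentation.exists_fin (A ⊗[k] K) C
  obtain ⟨S, hS⟩ := hNfg
  -- the finitely many elements of `K` occurring in the generators; the field `l`
  have hdec : ∀ (s : Fin n → A ⊗[k] K) (j : Fin n),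
      ∃ T : Finset (A × K), s j = ∑ p ∈ T, p.1 ⊗ₜ[k] p.2 :=
    fun s j => TensorProduct.exists_finset (s j)
  choose T hT using hdec
  let E : Finset K := S.biUnion fun s => Finset.univ.biUnion fun j => (T s j).image Prod.snd
  let l : IntermediateField k K := IntermediateField.adjoin k (E : Set K)
  haveI : FiniteDimensional k l := IntermediateField.finiteDimensional_adjoin
    fun x _ => (Algebra.IsAlgebraic.isAlgebraic (R := k) x).isIntegral
  -- register `Algebra k ↥l` locally (instance search does not find it under `⧸` otherwise)
  letI : Algebra k l := inferInstance
  have hEl : ∀ s ∈ S, ∀ (j : Fin n), ∀ p ∈ T s j, p.2 ∈ l := by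
    intro s hs j p hp
    apply IntermediateField.subset_adjoin k (E : Set K)
    rw [Finset.mem_coe, Finset.mem_biUnion]
    exact ⟨s, hs, Finset.mem_biUnion.mpr ⟨j, Finset.mem_univ _, Finset.mem_image.mpr ⟨p, hp, rfl⟩⟩⟩
  -- lifts of the generators to `(A ⊗ₖ l)ⁿ`
  let incl' : (Fin n → A ⊗[k] l) →ₗ[A] (Fin n → A ⊗[k] K) :=
    (Algebra.TensorProduct.map (AlgHom.id A A) (IsScalarTower.toAlgHom k l K)).toLinearMap.compLeft
      (Fin n)
  let lift : S → (Fin n → A ⊗[k] l) := fun s j =>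
    ∑ p ∈ (T s.1 j).attach, p.1.1 ⊗ₜ[k] (⟨p.1.2, hEl s.1 s.2 j p.1 p.2⟩ : l)
  have hlift : ∀ s : S, incl' (lift s) = s.1 := by
    intro s
    funext j
    change Algebra.TensorProduct.map (AlgHom.id A A) (IsScalarTower.toAlgHom k l K) (lift s j) = _
    simp only [lift, map_sum, Algebra.TensorProduct.map_tmul, AlgHom.coe_id, id_eq,
      IsScalarTower.coe_toAlgHom', IntermediateField.algebraMap_apply]
    rw [Finset.sum_attach (T s.1 j) (fun p => p.1 ⊗ₜ[k] p.2), ← hT]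
  have hspan : Submodule.span (A ⊗[k] K) (incl' '' Set.range lift) = N := by
    rw [← hS]
    congr 1
    ext x
    constructor
    · rintro ⟨_, ⟨s, rfl⟩, rfl⟩
      rw [hlift]
      exact s.2
    · intro hx
      exact ⟨lift ⟨x, hx⟩, ⟨⟨x, hx⟩, rfl⟩, hlift ⟨x, hx⟩⟩
  obtain ⟨ε⟩ := nonempty_quotient_linearEquiv_finsupp k K A l N (Set.range lift) hspan
  -- the descended module `G = (A ⊗ₖ l)ⁿ / N'`, finitely generated over `A`
  let N' : Submodule (A ⊗[k] l) (Fin n → A ⊗[k] l) := Submodule.span (A ⊗[k] l) (Set.range lift)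
  haveI : Module.Finite A (A ⊗[k] l) := inferInstance
  haveI : Module.Finite A ((Fin n → A ⊗[k] l) ⧸ N') :=
    Module.Finite.of_surjective (N'.mkQ.restrictScalars A) (Submodule.mkQ_surjective N')
  refine ⟨ModuleCat.of A ((Fin n → A ⊗[k] l) ⧸ N'), Module.Free.ChooseBasisIndex l K,
    inferInstance, ⟨?_⟩⟩
  -- the `A`-linear isomorphism `C|_A ≅ (A ⊗ₖ K)ⁿ/N ≅ ι →₀ G`
  have hesmul : ∀ (a : A) (c : C), e (algebraMap A (A ⊗[k] K) a • c) = a • e c := fun a c => by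
    rw [LinearEquiv.map_smul, algebraMap_smul]
  letI : Module A C := ((restrictScalarsFunctor A (A ⊗[k] K)).obj C).isModule
  let e' : (restrictScalarsFunctor A (A ⊗[k] K)).obj C ≃ₗ[A] ((Fin n → A ⊗[k] K) ⧸ N) :=
    { toFun := fun c => e c
      map_add' := fun x y => e.map_add x y
      map_smul' := fun a c => hesmul a c
      invFun := fun q => e.symm q
      left_inv := fun c => e.symm_apply_apply c
      right_inv := fun q => e.apply_symm_apply q }
  exact (e' ≪≫ₗ ε).toModuleIso

/-- **`C|_A ∈ Add G` for a finitely generated `A`-module `G`** (`K/k` algebraic, `C` finitely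
presented over `A ⊗ₖ K`): the form used with the compactness Lemma 4.8 (`Compactness.lean`,
`IsRetractOfCopower`). [cite: IyengarTakahashi2014, Thm. 5.4 (proof)] -/
theorem exists_isRetractOfCopower_restrictScalars [Algebra.IsAlgebraic k K]
    (C : ModuleCat.{u} (A ⊗[k] K)) [Module.FinitePresentation (A ⊗[k] K) C] :
    ∃ G : ModuleCat.{u} A, Module.Finite A G ∧
      IsRetractOfCopower G ((restrictScalarsFunctor A (A ⊗[k] K)).obj C) := by
  obtain ⟨G, ι, hG, ⟨e⟩⟩ := exists_iso_finsupp_restrictScalars k K A C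
  exact ⟨G, hG, ι, e.hom, e.inv, e.hom_inv_id⟩

/-- The same for finitely generated modules when `A` is of finite type over `k` (then `A ⊗ₖ K` is
noetherian and finitely generated modules are finitely presented).
[cite: IyengarTakahashi2014, Thm. 5.4 (proof)] -/
theorem exists_isRetractOfCopower_restrictScalars_of_finite [Algebra.IsAlgebraic k K]
    [Algebra.FiniteType k A] (C : ModuleCat.{u} (A ⊗[k] K)) [Module.Finite (A ⊗[k] K) C] :
    ∃ G : ModuleCat.{u} A, Module.Finite A G ∧
      IsRetractOfCopower G ((restrictScalarsFunctor A (A ⊗[k] K)).obj C) := by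
  haveI : IsNoetherianRing (A ⊗[k] K) := by
    haveI : IsNoetherianRing (K ⊗[k] A) := Algebra.FiniteType.isNoetherianRing K _
    exact isNoetherianRing_of_ringEquiv (K ⊗[k] A) (Algebra.TensorProduct.comm k K A).toRingEquiv
  haveI : Module.FinitePresentation (A ⊗[k] K) C := Module.finitePresentation_of_finite _ _
  exact exists_isRetractOfCopower_restrictScalars k K A C

/-- **Generator descent (the hypothesis `hAdd` of `strongGenerator_descent_of_generatorDescent`,
`StrongGeneratorDescentField.lean`), PROVED**: for `K/k` algebraic and `A` of finite type over
`k`, every finitely generated `(K ⊗ₖ A)`-module `G'`, restricted to `A` along `a ↦ 1 ⊗ a`, lies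
in `Add G₀` for some finitely generated `A`-module `G₀` (transport of
`exists_isRetractOfCopower_restrictScalars_of_finite` along `Algebra.TensorProduct.comm`).
[cite: IyengarTakahashi2014, Thm. 5.4 (proof)] -/
theorem generatorDescent_isRetractOfCopower :
    ∀ (k K : Type u) [Field k] [Field K] [Algebra k K] [Algebra.IsAlgebraic k K]
      (A : Type u) [CommRing A] [Algebra k A], Algebra.FiniteType k A →
      ∀ (G' : ModuleCat.{u} (K ⊗[k] A)), Module.Finite (K ⊗[k] A) G' →
        ∃ G₀ : ModuleCat.{u} A, Module.Finite A G₀ ∧ IsRetractOfCopower G₀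
          ((ModuleCat.restrictScalars.{u}
            (Algebra.TensorProduct.includeRight (R := k) (A := K) (B := A)).toRingHom).obj G') := by
  intro k K _ _ _ _ A _ _ hA G' hG'
  haveI := hA
  haveI := hG'
  let σ : A ⊗[k] K ≃ₐ[k] K ⊗[k] A := Algebra.TensorProduct.comm k A K
  -- `G'` as a module over `A ⊗ₖ K` through `σ`
  letI algσ : Algebra (A ⊗[k] K) (K ⊗[k] A) := (σ : A ⊗[k] K →+* K ⊗[k] A).toAlgebra
  have hσsurj : Function.Surjective (algebraMap (A ⊗[k] K) (K ⊗[k] A)) := σ.surjective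
  let C : ModuleCat.{u} (A ⊗[k] K) := (restrictScalarsFunctor (A ⊗[k] K) (K ⊗[k] A)).obj G'
  haveI : Module.Finite (A ⊗[k] K) C := finite_restrictScalars_of_surjective hσsurj G'
  obtain ⟨G₀, hG₀, hret⟩ := exists_isRetractOfCopower_restrictScalars_of_finite k K A C
  refine ⟨G₀, hG₀, ?_⟩
  -- `a ↦ 1 ⊗ a` is `σ ∘ (a ↦ a ⊗ 1)`
  have hcomp : (Algebra.TensorProduct.includeRight (R := k) (A := K) (B := A)).toRingHom =
      (algebraMap (A ⊗[k] K) (K ⊗[k] A)).comp (algebraMap A (A ⊗[k] K)) := by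
    refine RingHom.ext fun a => ?_
    change (1 : K) ⊗ₜ[k] a = σ (algebraMap A (A ⊗[k] K) a)
    rw [Algebra.TensorProduct.algebraMap_apply, Algebra.algebraMap_self, RingHom.id_apply]
    simp [σ]
  exact hret.of_iso (ModuleCat.restrictScalarsComp'App (algebraMap A (A ⊗[k] K))
    (algebraMap (A ⊗[k] K) (K ⊗[k] A)) _ hcomp G').symm

end Descent

/-! ## Theorem 5.4 of Iyengar–Takahashi, discharged -/

/-- **[IyengarTakahashi2014, Theorem 5.4], PROVED** — the named fact `singEqVCa_essFiniteType`
(`AnnihilationOfCohomology.lean`): for `R` a localisation of a finitely generated algebra of Krull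
dimension `d` over a field, `V(ca R) = V(ca^{2d+1} R) = Sing R`. Assembly of the tree's pieces:
the reduction to the three printed inputs (`StrongGeneratorReduction.lean`), Theorem 3.6 over
perfect fields (`AffineDomainAnnihilator.lean`, via separable Noether normalisation), Theorem 5.2
(`StrongGeneratorInduction.lean`), the descent of a strong generator along `A → K ⊗ₖ A`
(`StrongGeneratorDescentCore.lean`, `StrongGeneratorDescentField.lean`, Lemma 4.8 in
`Compactness.lean`) and the generator descent `generatorDescent_isRetractOfCopower` above.
[cite: IyengarTakahashi2014, Thm. 5.4] -/
theorem singEqVCa_essFiniteType_holds : singEqVCa_essFiniteType.{u} :=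
  singEqVCa_essFiniteType_of_descent
    (strongGenerator_descent_of_generatorDescent generatorDescent_isRetractOfCopower)

end Literature.RingTheory.CohomologyAnnihilator

end
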